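import Mathlib
import HarnessLib

/-!
# `NoHeavyLowerTail` (crux stmt-CriticalPhenomena-4575), antithetic vdBHK programme: the CYCLE-SHORTENING GADGET of THEOREM COβ — finite Λ-facts

Support file (seat `prim-ineq-gen-7` gen 48; `--supports stmt-CriticalPhenomena-4575`).  No `sorry`, no definitions; `decide` lemmas.
Memo: run/shared/lean/prim/prim-ineq-gen-7/PROOF-COBETA-g48.md §2 (GADGET LEMMA; uniqueness by exhaustive search, HOME/code/g48/gadget.py).

THE GADGET.  In a β-cycle `… a_{k-2} < x_{k-2} > a_{k-1} < x_{k-1} > a_0 …` the path `x_{k-2} – a_{k-1} – x_{k-1}` is contracted into ONE virtual top `X` over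
`(a_{k-2}, a_0)` whose Λ-label (`0 = RI, 1 = RN, 2 = BN, 3 = BI`) is `gad L₁ μ L₂` (`L₁, L₂` the labels of the two tops, `μ` the colour of the middle atom,
`true` = red):  `μ` red:  `RI` if `L₁ = L₂ = RI`, `BN` if one of them is `BN`, else `RN`;  `μ` blue: `BI` if `L₁ = L₂ = BI`, `RN` if one of them is `RN`, else `BN`.
Equivalently colour(`X`) = MAJ(colour `x_{k-2}`, ¬ colour `a_{k-1}`, colour `x_{k-1}`), interior iff both tops are interior.  A top label `L` over an atom of
colour `μ` is REALIZABLE if `L = RI ⇒ μ` red and `L = BI ⇒ μ` blue.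
* `gadget_mono`  — (G1) monotone in the Λ-order `leL` (`AntitheticCrownUniversal`) along realizable arguments, the atom turning only red → blue;
* `gadget_values` — range `< 4`, `= RI` iff both `RI`, `= BI` iff both `BI`;  `gadget_compl` — (G2) ι-equivariance;  `gadget_red` — the colour of `X` is the
  majority of (red `x_{k-2}`, blue `a_{k-1}`, red `x_{k-1}`) (hence balanced and self-dual: (G4)).
-/

namespace Summit.CriticalPhenomena.PercolationContinuityZ3.Theorems

namespace AntitheticCycleGadget

set_option synthInstance.maxHeartbeats 400000 in
set_option synthInstance.maxSize 4096 in
/-- (G1) The gadget is monotone for the Λ-order along realizable label pairs (middle atom red → blue only). [this work] -/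
theorem gadget_mono
    (leL : ℕ → ℕ → Bool)
    (hleL : leL = fun p q => p == q || (p == 0 && q == 1) || (p == 0 && q == 3) || (p == 2 && q == 1) || (p == 2 && q == 3))
    (gad : ℕ → Bool → ℕ → ℕ)
    (hgad : gad = fun L1 m L2 => if m = true then (if L1 = 0 ∧ L2 = 0 then 0 else if L1 = 2 ∨ L2 = 2 then 2 else 1)
      else (if L1 = 3 ∧ L2 = 3 then 3 else if L1 = 1 ∨ L2 = 1 then 1 else 2)) :
    ∀ (m m' : Bool) (L1 L2 L1' L2' : Fin 4), (m' = true → m = true) →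
      (L1.val = 0 → m = true) → (L1.val = 3 → m = false) → (L2.val = 0 → m = true) → (L2.val = 3 → m = false) →
      (L1'.val = 0 → m' = true) → (L1'.val = 3 → m' = false) → (L2'.val = 0 → m' = true) → (L2'.val = 3 → m' = false) →
      leL L1.val L1'.val = true → leL L2.val L2'.val = true → leL (gad L1.val m L2.val) (gad L1'.val m' L2'.val) = true := by
  subst hleL; subst hgad
  decide

/-- Values of the gadget: below `4`; `RI` exactly when both tops are `RI`; `BI` exactly when both are `BI` (realizability (G3) of the virtual top). [this work] -/
theorem gadget_values
    (gad : ℕ → Bool → ℕ → ℕ)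
    (hgad : gad = fun L1 m L2 => if m = true then (if L1 = 0 ∧ L2 = 0 then 0 else if L1 = 2 ∨ L2 = 2 then 2 else 1)
      else (if L1 = 3 ∧ L2 = 3 then 3 else if L1 = 1 ∨ L2 = 1 then 1 else 2)) :
    ∀ (m : Bool) (L1 L2 : Fin 4), (L1.val = 0 → m = true) → (L2.val = 3 → m = false) →
      gad L1.val m L2.val < 4 ∧ (gad L1.val m L2.val = 0 ↔ (L1.val = 0 ∧ L2.val = 0)) ∧ (gad L1.val m L2.val = 3 ↔ (L1.val = 3 ∧ L2.val = 3)) := by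
  subst hgad
  decide

/-- (G2) ι-equivariance: complementing all labels (`l ↦ 3 - l`) and the atom colour complements the gadget. [this work] -/
theorem gadget_compl
    (gad : ℕ → Bool → ℕ → ℕ)
    (hgad : gad = fun L1 m L2 => if m = true then (if L1 = 0 ∧ L2 = 0 then 0 else if L1 = 2 ∨ L2 = 2 then 2 else 1)
      else (if L1 = 3 ∧ L2 = 3 then 3 else if L1 = 1 ∨ L2 = 1 then 1 else 2)) :
    ∀ (m : Bool) (L1 L2 : Fin 4), gad (3 - L1.val) (!m) (3 - L2.val) = 3 - gad L1.val m L2.val := by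
  subst hgad
  decide

/-- The colour of the virtual top (label `< 2` = red) is the MAJORITY of (first top red, middle atom BLUE, second top red), for realizable arguments;
in particular it is a self-dual Boolean function of the three colours (balance (G4)). [this work] -/
theorem gadget_red
    (gad : ℕ → Bool → ℕ → ℕ)
    (hgad : gad = fun L1 m L2 => if m = true then (if L1 = 0 ∧ L2 = 0 then 0 else if L1 = 2 ∨ L2 = 2 then 2 else 1)
      else (if L1 = 3 ∧ L2 = 3 then 3 else if L1 = 1 ∨ L2 = 1 then 1 else 2)) :
    ∀ (m : Bool) (L1 L2 : Fin 4), (L1.val = 0 → m = true) → (L1.val = 3 → m = false) → (L2.val = 0 → m = true) → (L2.val = 3 → m = false) →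
      decide (gad L1.val m L2.val < 2) = ((decide (L1.val < 2) && !m) || (decide (L1.val < 2) && decide (L2.val < 2)) || (!m && decide (L2.val < 2))) := by
  subst hgad
  decide

end AntitheticCycleGadget

end Summit.CriticalPhenomena.PercolationContinuityZ3.Theorems
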